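import Literature.NumberTheory.EllipticCurves.TowerSaturatedExactRepProofs
import Literature.NumberTheory.EllipticCurves.ZpExtensionEisensteinDVRSettingH4ValueMapsProofs
import Literature.NumberTheory.EllipticCurves.ZpExtensionEisensteinDVRSettingH4LimitExactProofs
import Literature.NumberTheory.EllipticCurves.ZpExtensionEisensteinDVRSettingH4TransferAdjointProofs
import Literature.NumberTheory.EllipticCurves.ZpExtensionEisensteinDVRSettingH4TransferFormProofs
import HarnessLib

/-!
# H.4 at the places `v ∣ p` for the curve's Eisenstein setting, XII: (EXACT-REP) INSTANTIATED — a compatible family of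
# `H¹(K_v, Tw T^{(•)})` orthogonal at level `k` to the saturated families of `H¹(K_v, T^{(•)})` is `p^{k+1} y″` up to a family
# orthogonal to them at EVERY level

`Proofs` file (theorems only; no definition, no named fact, no instance, no `sorry`).  The assembly of x9-p1-w2's generic
`Tower.exists_sub_pow_smul_forall_pairing_eq_zero` (`TowerSaturatedExactRepProofs`) for the `D`-indexed local towers
`X_j = H¹(K_v, T^{(j)})`, `Y_j = H¹(K_v, Tw T^{(j)})`, `Q_j = H²(K_v, A_{m,j+1}(1))` of the curve's Eisenstein setting
(`T^{(j)} = E_K[p^{j+1}] ⊗ A_{m,j+1}(ψ)`) at a finite place `v`, with the induced local pairings `B_j = (D j).localCup v` of ANY H.4 data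
`D j` over `A_{m,j+1}` satisfying the reduction identity `he_red`, given the Poitou–Tate named fact: every one of the 25 inputs of the
generic theorem is a landed lemma of the cell —
`hX` (T) / `hB` (`eisensteinTower_localCup_red`) [`…H4TowerPairingProofs`], the readings `λ_j`, `hsurj`, `hfrob`, `hBlin`
[`…H4ReadingsProofs`], `hSat` (`Tower.map_mem_saturatedFamilies` + semilinearity of `H¹(red)`), `hE` [`…H4LimitExactProofs`], the value maps
`ι_i = H²(×p^{k+1})` with `hιinj` [`IwasawaAlgebraEisensteinValueMapTwoInjectiveProofs`], `hιS`, `hιred`, `hιrange` [`…H4ValueMapsProofs`],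
the two-index maps `UP/DOWN/UP′/DOWN′ = H¹(F a b)` with `hUP`, `hDOWN`, `hUP′`, `hDOWN′` [`…H4TransferFormProofs`] and `hAdj0`, `hAdj′`
[`…H4TransferAdjointProofs`].  Scalars: `g ∈ Λ` acting by `H¹([g] ·)`, `H²([g] ·)`.

* `eisensteinTower_red_smul`, `eisensteinTower_red_scalarMapH1` — `red_j (c x) = reduce(c) red_j x` and `H¹(red_j) (H¹(c ·) x) =
  H¹(reduce c ·) (H¹(red_j) x)` in the cell's currency;
* **`eisensteinTower_exists_sub_pow_smul_forall_localCup_eq_zero`** — for cores `C_j ≤ X_j` stable under `H¹(c ·)` (`c ∈ A_{m,j+1}`),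
  `η ∈ lim_j Y_j` with `ξ_k ∪ η_k = 0` for all saturated `ξ`: `∃ y″ ∈ lim_j Y_j, ∀ j, ∀ ξ` saturated, `ξ_j ∪ (η_j − p^{k+1} y″_j) = 0`.

With x9-p1-w4's (ANN-SAT) `eisensteinTower_mem_saturatedFamilies_of_forall_localCup_eq_zero` this is the `Y`-side exactness clause
`hExactY` of `Stmt.exactAtP` (LEAD g8's `h4AtS_of_exactAtP`).  Cell `pub/bsd-print-x9` (STUB A `hfin4` at `v ∣ p`).  No summit statement
is proved here; BSD is not proved by any of this.  References: [Howard2004HeegnerKolyvagin] Def. 1.1.1–1.1.3, §1.3 H.4, §1.6, Lemma 3.2.7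
(arXiv:1202.6340 p. 5, p. 7 L78–82, p. 11–12, p. 16); [MilneADT2006] I Cor. 2.3; [SerreGaloisCohomology1997] I §2.2, II §5.
-/

set_option autoImplicit false

noncomputable section

open Function NumberField IsDedekindDomain Field CategoryTheory
open scoped NumberField ContRepresentation

namespace WeierstrassCurve

open Literature.NumberTheory.EllipticCurves Literature.NumberTheory.GaloisRepresentations
open Literature.NumberTheory.GaloisRepresentations.DiscreteGaloisModule
open Literature.NumberTheory.GaloisCohomology Literature.NumberTheory.GaloisCohomology.Howard2004
open Literature.NumberTheory.EllipticCurves.ZpExtension (EisensteinLevel)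

variable {K : Type} [Field K] [NumberField K] (W : WeierstrassCurve ℚ) [W.IsElliptic] {p : ℕ} [hp : Fact p.Prime]
  (κ : ZpExtension K p) {m : ℕ} (hm : 1 ≤ m) (cd : ConjugationDatum K)
  (D : letI := IwasawaAlgebra.isLocalRing_quotient_X_pow_add_C p hm
    ∀ k, DualityDatum p cd ((W.eisensteinTower κ hm).ρ k) (IwasawaAlgebra.EisensteinCoeff p m (k + 1)))
  (he_red : letI := IwasawaAlgebra.isLocalRing_quotient_X_pow_add_C p hm
    ∀ k (x y : EisensteinLevel p m (fun j ↦ geomTorsion (W.baseChange K) ((p : ℤ) ^ j)) (k + 1 + 1)),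
      IwasawaAlgebra.EisensteinCoeff.reduce p m (Nat.le_succ (k + 1)) ((D (k + 1)).e x y) =
        (D k).e ((W.eisensteinTower κ hm).red k x) ((W.eisensteinTower κ hm).red k y))

/-! ## §1 `H¹(red)` is semilinear over `reduce` (cell currency) -/

/-- **`red_j (a · x) = reduce(a) · red_j x`**: the one-step reduction `T^{(j+1)} → T^{(j)}` of the curve's tower is semilinear over
the ring reduction `A_{m,j+2} → A_{m,j+1}` (both scalar actions come from `S_m = Λ/(T^m+p)`, over which `red_j` is linear).
[cite: Howard2004HeegnerKolyvagin, §1.6 (arXiv p. 11 L13–20, p. 12 L29–33) and Def. 1.1.3] -/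
theorem eisensteinTower_red_smul (j : ℕ) (a : IwasawaAlgebra.EisensteinCoeff p m (j + 1 + 1))
    (x : EisensteinLevel p m (fun j ↦ geomTorsion (W.baseChange K) ((p : ℤ) ^ j)) (j + 1 + 1)) :
    letI := IwasawaAlgebra.isLocalRing_quotient_X_pow_add_C p hm
    (W.eisensteinTower κ hm).red j (a • x) =
      IwasawaAlgebra.EisensteinCoeff.reduce p m (Nat.le_succ (j + 1)) a • (W.eisensteinTower κ hm).red j x := by
  letI := IwasawaAlgebra.isLocalRing_quotient_X_pow_add_C p hm
  obtain ⟨r, rfl⟩ := IwasawaAlgebra.EisensteinCoeff.ofSpec_surjective (p := p) m (j + 1 + 1) a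
  letI := IwasawaAlgebra.EisensteinCoeff.algebraOfSpecSucc p m (j + 1)
  haveI := W.isScalarTower_algebraOfSpecSucc (K := K) (p := p) (m := m) (j + 1)
  have h1 : IwasawaAlgebra.EisensteinCoeff.ofSpec p m (j + 1 + 1) r • x = r • x := algebraMap_smul _ r x
  have h2 : IwasawaAlgebra.EisensteinCoeff.ofSpec p m (j + 1) r • (W.eisensteinTower κ hm).red j x =
      r • (W.eisensteinTower κ hm).red j x := by
    letI := IwasawaAlgebra.EisensteinCoeff.algebraOfSpecSucc p m j
    haveI := W.isScalarTower_algebraOfSpecSucc (K := K) (p := p) (m := m) j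
    exact algebraMap_smul _ r _
  rw [IwasawaAlgebra.EisensteinCoeff.reduce_ofSpec, h1, h2, LinearMap.map_smul]

/-- **`H¹(red_j) (H¹(c ·) x) = H¹(reduce c ·) (H¹(red_j) x)`** on `H¹(K_v, T^{(j+1)}) → H¹(K_v, T^{(j)})` for `c ∈ A_{m,j+2}`
(`red_j` is semilinear over the ring reduction; on cocycles, as in x9-p1-w4's `scalarMapH1_cohomologyMap_of_semilinear`).
[cite: Howard2004HeegnerKolyvagin, Def. 1.1.1 and Def. 1.1.3 (arXiv p. 5)] [cite: SerreGaloisCohomology1997, Ch. I §2.2 and §5.1] -/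
theorem eisensteinTower_red_scalarMapH1 (v : Place K) (j : ℕ) (c : IwasawaAlgebra.EisensteinCoeff p m (j + 1 + 1))
    (x : letI := IwasawaAlgebra.isLocalRing_quotient_X_pow_add_C p hm
      galoisCohomology (((W.eisensteinTower κ hm).ρ (j + 1)).toLocal v) 1) :
    letI := IwasawaAlgebra.isLocalRing_quotient_X_pow_add_C p hm
    ContinuousRep.cohomologyMap (((W.eisensteinTower κ hm).ρ (j + 1)).toLocal v) (((W.eisensteinTower κ hm).ρ j).toLocal v)
        ((W.eisensteinTower κ hm).red j).toAddMonoidHom continuous_of_discreteTopology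
        (fun _ z => (W.eisensteinTower κ hm).red_equivariant j _ z) 1
        (galoisCohomology.scalarMapH1 (((W.eisensteinTower κ hm).ρ (j + 1)).toLocal v)
          (DualityDatum.isScalarLinear_toLocal
            (κ.isScalarLinear_eisensteinAdicTowerSucc_coeff (fun j ↦ (W.baseChange K).torsionGaloisModule ((p : ℤ) ^ j))
              (fun j ↦ (W.baseChange K).torsionGaloisModuleReduce p j) hm
              (fun j ↦ (W.baseChange K).torsionGaloisModuleReduce_surjective p j) (j + 1)) v) c x) =
      galoisCohomology.scalarMapH1 (((W.eisensteinTower κ hm).ρ j).toLocal v)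
        (DualityDatum.isScalarLinear_toLocal
          (κ.isScalarLinear_eisensteinAdicTowerSucc_coeff (fun j ↦ (W.baseChange K).torsionGaloisModule ((p : ℤ) ^ j))
            (fun j ↦ (W.baseChange K).torsionGaloisModuleReduce p j) hm
            (fun j ↦ (W.baseChange K).torsionGaloisModuleReduce_surjective p j) j) v)
        (IwasawaAlgebra.EisensteinCoeff.reduce p m (Nat.le_succ (j + 1)) c)
        (ContinuousRep.cohomologyMap (((W.eisensteinTower κ hm).ρ (j + 1)).toLocal v) (((W.eisensteinTower κ hm).ρ j).toLocal v)
          ((W.eisensteinTower κ hm).red j).toAddMonoidHom continuous_of_discreteTopology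
          (fun _ z => (W.eisensteinTower κ hm).red_equivariant j _ z) 1 x) := by
  letI := IwasawaAlgebra.isLocalRing_quotient_X_pow_add_C p hm
  obtain ⟨c', rfl⟩ := oneCocycleClass_surjective _ x
  rw [galoisCohomology.scalarMapH1_oneCocycleClass]
  change ContinuousCohomology.map _ _ 1 (oneCocycleClass _ _) =
    galoisCohomology.scalarMapH1 _ _ _ (ContinuousCohomology.map _ _ 1 (oneCocycleClass _ c'))
  rw [map_oneCocycleClass, map_oneCocycleClass, galoisCohomology.scalarMapH1_oneCocycleClass]
  congr 1
  refine Subtype.ext (ContinuousMap.ext fun σ ↦ ?_)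
  exact W.eisensteinTower_red_smul κ hm j c (c'.1 σ)

/-! ## §2 (EXACT-REP) instantiated, `Y`-side -/

set_option maxHeartbeats 400000 in
include he_red in
/-- **(EXACT-REP) for the curve's Eisenstein setting at a finite place `v`, `Y`-side.**  For ANY H.4 data `D j` over `A_{m,j+1}`
satisfying `he_red`, cores `C_j ≤ H¹(K_v, T^{(j)})` stable under the scalar action `H¹(c ·)` of `A_{m,j+1}`, a level `k` and a
compatible family `η` of `(H¹(K_v, Tw T^{(j)}))_j` with `ξ_k ∪_k η_k = 0` for every saturated family `ξ` of the cores: there is a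
compatible family `y″` with `ξ_j ∪_j (η_j − p^{k+1} y″_j) = 0` for every `j` and every saturated `ξ` — given the Poitou–Tate named fact.
(With (ANN-SAT) the difference is saturated for the conjugate cores: the `Y`-side exactness clause of H.4 for `F_𝔮`.)
[cite: Howard2004HeegnerKolyvagin, §1.3 H.4 (arXiv p. 7, L78–82), Def. 1.1.1–1.1.3, §1.6, Lemma 3.2.7] [cite: MilneADT2006, Ch. I, Cor. 2.3] -/
theorem eisensteinTower_exists_sub_pow_smul_forall_localCup_eq_zero (hPT : poitouTate_selmerStructure_duality K)
    (v : HeightOneSpectrum (𝓞 K))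
    (C : letI := IwasawaAlgebra.isLocalRing_quotient_X_pow_add_C p hm
      ∀ j, AddSubgroup (galoisCohomology (((W.eisensteinTower κ hm).ρ j).toLocal (Sum.inr v)) 1))
    (hC : letI := IwasawaAlgebra.isLocalRing_quotient_X_pow_add_C p hm
      ∀ (j : ℕ) (c : IwasawaAlgebra.EisensteinCoeff p m (j + 1))
        (x : galoisCohomology (((W.eisensteinTower κ hm).ρ j).toLocal (Sum.inr v)) 1), x ∈ C j →
        galoisCohomology.scalarMapH1 (((W.eisensteinTower κ hm).ρ j).toLocal (Sum.inr v))
          (DualityDatum.isScalarLinear_toLocal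
            (κ.isScalarLinear_eisensteinAdicTowerSucc_coeff (fun j ↦ (W.baseChange K).torsionGaloisModule ((p : ℤ) ^ j))
              (fun j ↦ (W.baseChange K).torsionGaloisModuleReduce p j) hm
              (fun j ↦ (W.baseChange K).torsionGaloisModuleReduce_surjective p j) j) (Sum.inr v)) c x ∈ C j)
    (k : ℕ)
    {η : Π j, letI := IwasawaAlgebra.isLocalRing_quotient_X_pow_add_C p hm
      galoisCohomology ((cd.twist ((W.eisensteinTower κ hm).ρ j)).toLocal (Sum.inr v)) 1}
    (hη : letI := IwasawaAlgebra.isLocalRing_quotient_X_pow_add_C p hm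
      η ∈ Tower.compatibleFamilies (H := fun j ↦ galoisCohomology ((cd.twist ((W.eisensteinTower κ hm).ρ j)).toLocal (Sum.inr v)) 1)
        (fun j ↦ ContinuousRep.cohomologyMap ((cd.twist ((W.eisensteinTower κ hm).ρ (j + 1))).toLocal (Sum.inr v))
          ((cd.twist ((W.eisensteinTower κ hm).ρ j)).toLocal (Sum.inr v)) ((W.eisensteinTower κ hm).red j).toAddMonoidHom
          continuous_of_discreteTopology (fun _ z => (W.eisensteinTower κ hm).red_equivariant j _ z) 1))
    (hη0 : letI := IwasawaAlgebra.isLocalRing_quotient_X_pow_add_C p hm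
      ∀ ξ ∈ Tower.saturatedFamilies (H := fun j ↦ galoisCohomology (((W.eisensteinTower κ hm).ρ j).toLocal (Sum.inr v)) 1)
          (fun j ↦ ContinuousRep.cohomologyMap (((W.eisensteinTower κ hm).ρ (j + 1)).toLocal (Sum.inr v))
            (((W.eisensteinTower κ hm).ρ j).toLocal (Sum.inr v)) ((W.eisensteinTower κ hm).red j).toAddMonoidHom
            continuous_of_discreteTopology (fun _ z => (W.eisensteinTower κ hm).red_equivariant j _ z) 1) p C,
        (D k).localCup (Sum.inr v) (ξ k) (η k) = 0) :
    letI := IwasawaAlgebra.isLocalRing_quotient_X_pow_add_C p hm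
    ∃ y'' ∈ Tower.compatibleFamilies (H := fun j ↦ galoisCohomology ((cd.twist ((W.eisensteinTower κ hm).ρ j)).toLocal (Sum.inr v)) 1)
        (fun j ↦ ContinuousRep.cohomologyMap ((cd.twist ((W.eisensteinTower κ hm).ρ (j + 1))).toLocal (Sum.inr v))
          ((cd.twist ((W.eisensteinTower κ hm).ρ j)).toLocal (Sum.inr v)) ((W.eisensteinTower κ hm).red j).toAddMonoidHom
          continuous_of_discreteTopology (fun _ z => (W.eisensteinTower κ hm).red_equivariant j _ z) 1),
      ∀ j, ∀ ξ ∈ Tower.saturatedFamilies (H := fun j ↦ galoisCohomology (((W.eisensteinTower κ hm).ρ j).toLocal (Sum.inr v)) 1)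
          (fun j ↦ ContinuousRep.cohomologyMap (((W.eisensteinTower κ hm).ρ (j + 1)).toLocal (Sum.inr v))
            (((W.eisensteinTower κ hm).ρ j).toLocal (Sum.inr v)) ((W.eisensteinTower κ hm).red j).toAddMonoidHom
            continuous_of_discreteTopology (fun _ z => (W.eisensteinTower κ hm).red_equivariant j _ z) 1) p C,
        (D j).localCup (Sum.inr v) (ξ j) (η j - p ^ (k + 1) • y'' j) = 0 := by
  letI := IwasawaAlgebra.isLocalRing_quotient_X_pow_add_C p hm
  have hpp := hp.out
  have hpK : (p : K) ≠ 0 := by exact_mod_cast hpp.ne_zero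
  -- finiteness of the levels
  haveI : ∀ j, Finite (geomTorsion (W.baseChange K) ((p : ℤ) ^ j)) := fun j ↦
    finite_torsionPoints_holds (W.baseChange K) (AlgebraicClosure K) (pow_ne_zero _ (Int.natCast_ne_zero.mpr hpp.ne_zero))
  haveI hfinX : ∀ j, Finite (galoisCohomology (((W.eisensteinTower κ hm).ρ j).toLocal (Sum.inr v)) 1) := fun j ↦ by
    haveI : Finite (EisensteinLevel p m (fun j ↦ geomTorsion (W.baseChange K) ((p : ℤ) ^ j)) (j + 1)) :=
      IwasawaAlgebra.EisensteinCoeff.finite_twisted (p := p) (k := j + 1) (M := geomTorsion (W.baseChange K) ((p : ℤ) ^ (j + 1))) hm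
    exact finite_galoisCohomology_one_toLocal _ v
  haveI hfinY : ∀ j, Finite (galoisCohomology ((cd.twist ((W.eisensteinTower κ hm).ρ j)).toLocal (Sum.inr v)) 1) := fun j ↦ by
    haveI : Finite (EisensteinLevel p m (fun j ↦ geomTorsion (W.baseChange K) ((p : ℤ) ^ j)) (j + 1)) :=
      IwasawaAlgebra.EisensteinCoeff.finite_twisted (p := p) (k := j + 1) (M := geomTorsion (W.baseChange K) ((p : ℤ) ^ (j + 1))) hm
    exact finite_galoisCohomology_one_toLocal _ v
  haveI : ∀ j, NeZero (p ^ (j + 1)) := fun j ↦ ⟨pow_ne_zero _ hpp.ne_zero⟩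
  -- the scalars `g ∈ Λ` acting by `H¹([g] ·)` and `H²([g] ·)`
  letI instX : ∀ j, SMul (IwasawaAlgebra p) (galoisCohomology (((W.eisensteinTower κ hm).ρ j).toLocal (Sum.inr v)) 1) :=
    fun j ↦ ⟨fun g x ↦ galoisCohomology.scalarMapH1 (((W.eisensteinTower κ hm).ρ j).toLocal (Sum.inr v))
      (DualityDatum.isScalarLinear_toLocal
        (κ.isScalarLinear_eisensteinAdicTowerSucc_coeff (fun j ↦ (W.baseChange K).torsionGaloisModule ((p : ℤ) ^ j))
          (fun j ↦ (W.baseChange K).torsionGaloisModuleReduce p j) hm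
          (fun j ↦ (W.baseChange K).torsionGaloisModuleReduce_surjective p j) j) (Sum.inr v)) (Ideal.Quotient.mk _ g) x⟩
  letI instQ : ∀ j, SMul (IwasawaAlgebra p) (galoisCohomology ((D j).twistOne.toLocal (Sum.inr v)) 2) :=
    fun j ↦ ⟨fun g q ↦ galoisCohomology.scalarMap ((D j).twistOne.toLocal (Sum.inr v))
      (DualityDatum.isScalarLinear_toLocal (D j).isScalarLinear_twistOne (Sum.inr v)) 2 (Ideal.Quotient.mk _ g) q⟩
  -- the readings
  obtain ⟨lamQ, hlamQ⟩ := W.eisensteinTower_localCup_towerReadings κ hm cd D hPT v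
  -- the value maps `ι_i : A_{m,i+1} → A_{m,k+2+i}`, `ι_i ∘ reduce = p^{k+1} ·`
  have hki : ∀ i : ℕ, i + 1 ≤ k + 1 + i + 1 := fun i ↦ by omega
  choose ιmod hιmod using fun i ↦ IwasawaAlgebra.EisensteinCoeff.exists_addMonoidHom_apply_reduce_eq_pow_smul (p := p) m (hki i)
  have hι₁ : ∀ (i : ℕ) (x : IwasawaAlgebra.EisensteinCoeff p m (k + 1 + i + 1)),
      ιmod i (IwasawaAlgebra.EisensteinCoeff.reduce p m (hki i) x) = p ^ (k + 1 + i - i) • x := fun i x ↦ by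
    rw [hιmod, Nat.succ_sub_succ]
  have hι₂ : ∀ (i : ℕ) (x : IwasawaAlgebra.EisensteinCoeff p m (k + 1 + i + 1)),
      ιmod i (IwasawaAlgebra.EisensteinCoeff.reduce p m (hki i) x) = p ^ (k + 1) • x := fun i x ↦ by
    rw [hι₁, Nat.add_sub_cancel]
  -- the two-index maps
  let F := (W.baseChange K).eisensteinTwistTorsionTransfer κ hm
    (fun j ↦ (W.baseChange K).torsionGaloisModuleReduce p j) (W.torsionGaloisModuleReduce_coe (K := K) (p := p))
  obtain ⟨y'', hy'', h⟩ := Tower.exists_sub_pow_smul_forall_pairing_eq_zero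
    (X := fun j ↦ galoisCohomology (((W.eisensteinTower κ hm).ρ j).toLocal (Sum.inr v)) 1)
    (fun j ↦ ContinuousRep.cohomologyMap (((W.eisensteinTower κ hm).ρ (j + 1)).toLocal (Sum.inr v))
      (((W.eisensteinTower κ hm).ρ j).toLocal (Sum.inr v)) ((W.eisensteinTower κ hm).red j).toAddMonoidHom
      continuous_of_discreteTopology (fun _ z => (W.eisensteinTower κ hm).red_equivariant j _ z) 1)
    (Y := fun j ↦ galoisCohomology ((cd.twist ((W.eisensteinTower κ hm).ρ j)).toLocal (Sum.inr v)) 1)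
    (fun j ↦ ContinuousRep.cohomologyMap ((cd.twist ((W.eisensteinTower κ hm).ρ (j + 1))).toLocal (Sum.inr v))
      ((cd.twist ((W.eisensteinTower κ hm).ρ j)).toLocal (Sum.inr v)) ((W.eisensteinTower κ hm).red j).toAddMonoidHom
      continuous_of_discreteTopology (fun _ z => (W.eisensteinTower κ hm).red_equivariant j _ z) 1)
    (Q := fun j ↦ galoisCohomology ((D j).twistOne.toLocal (Sum.inr v)) 2)
    (fun j ↦ ContinuousRep.cohomologyMap ((D (j + 1)).twistOne.toLocal (Sum.inr v)) ((D j).twistOne.toLocal (Sum.inr v))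
      (IwasawaAlgebra.EisensteinCoeff.reduce p m (Nat.le_succ (j + 1))).toAddMonoidHom
      continuous_of_discreteTopology (fun _ z => W.reduce_twistOne κ hm cd D j _ z) 2)
    (fun j ↦ (D j).localCup (Sum.inr v)) p C
    (fun j x y ↦ W.eisensteinTower_localCup_red κ hm cd D he_red j (Sum.inr v) x y)
    (S := IwasawaAlgebra p) (fun j ↦ p ^ (j + 1))
    (fun j x ↦ W.eisensteinTower_toLocal_pow_nsmul_eq_zero κ hm j (Sum.inr v) x)
    lamQ (fun j χ ↦ (hlamQ j).1 χ)
    (fun j q q' hq ↦ (hlamQ j).2 q q' fun r ↦ by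
      obtain ⟨g, rfl⟩ := Ideal.Quotient.mk_surjective r
      exact hq g)
    (fun j g x y ↦ W.eisensteinTower_localCup_scalarMapH1_left κ hm cd D j (Sum.inr v) (Ideal.Quotient.mk _ g) x y)
    (fun g ξ hξ ↦ Tower.map_mem_saturatedFamilies _ p C
      (fun j ↦ galoisCohomology.scalarMapH1 (((W.eisensteinTower κ hm).ρ j).toLocal (Sum.inr v))
        (DualityDatum.isScalarLinear_toLocal
          (κ.isScalarLinear_eisensteinAdicTowerSucc_coeff (fun j ↦ (W.baseChange K).torsionGaloisModule ((p : ℤ) ^ j))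
            (fun j ↦ (W.baseChange K).torsionGaloisModuleReduce p j) hm
            (fun j ↦ (W.baseChange K).torsionGaloisModuleReduce_surjective p j) j) (Sum.inr v)) (Ideal.Quotient.mk _ g))
      (fun j x ↦ by
        have h := W.eisensteinTower_red_scalarMapH1 κ hm (Sum.inr v) j (Ideal.Quotient.mk _ g) x
        rw [IwasawaAlgebra.EisensteinCoeff.reduce_mk] at h
        exact h)
      (fun j x hx ↦ hC j _ x hx) hξ)
    (fun δ hδ i hδi ↦ W.eisensteinTower_exists_forall_eq_pow_smul_of_apply_eq_zero κ hm v hδ i hδi) k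
    (fun i ↦ ContinuousRep.cohomologyMap ((D i).twistOne.toLocal (Sum.inr v)) ((D (k + 1 + i)).twistOne.toLocal (Sum.inr v))
      (ιmod i) continuous_of_discreteTopology
      (fun _ z => (D i).twistOne_apply_of_apply_reduce (D (k + 1 + i)) (hki i) (ιmod i) (p ^ (k + 1)) (hι₂ i) _ z) 2)
    (fun i ↦ DualityDatum.cohomologyMap_two_injective_of_apply_reduce hm (hki i) (D i) (D (k + 1 + i)) (ιmod i) (hιmod i)
      (Sum.inr v))
    (fun i g q ↦ W.eisensteinTower_valueMap_scalarMap κ hm cd D (hki i) (ιmod i) (k + 1) (hι₂ i) (Sum.inr v) g q)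
    (fun i q ↦ W.eisensteinTower_valueMap_red κ hm cd D (k + 1) (hki (i + 1)) (ιmod (i + 1)) (hι₂ (i + 1)) (hki i) (ιmod i)
      (hι₂ i) (Sum.inr v) q)
    (fun i q hq ↦ W.eisensteinTower_valueMap_range κ hm cd D hPT v k i (hki i) (ιmod i) (hι₂ i) q hq)
    (fun i ↦ galoisCohomology.map (DiscreteGaloisModule.localMap (F (k + 1) (k + 1 + i + 1)) (Sum.inr v)) 1)
    (fun i ↦ galoisCohomology.map (DiscreteGaloisModule.localMap (DiscreteGaloisModule.restrictMap (F (k + 1 + i + 1) (k + 1))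
      cd.conj) (Sum.inr v)) 1)
    (fun i ξ hξ ↦ by
      have h := W.eisensteinTower_pow_smul_apply_eq_map_transfer κ hm (Sum.inr v) (show k ≤ k + 1 + i by omega) hξ
      rwa [show k + 1 + i - k = i + 1 by omega] at h)
    (fun i η' hη' ↦ W.eisensteinTower_map_transfer_apply_of_mem_compatibleFamilies_twist κ hm cd (Sum.inr v)
      (show k ≤ k + 1 + i by omega) hη')
    (fun i x w h0 ↦ W.eisensteinTower_localCup_transfer_eq_zero_of_eq_zero κ hm cd D he_red (show k ≤ k + 1 + i by omega)
      (Sum.inr v) x w h0)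
    (fun i ↦ galoisCohomology.map (DiscreteGaloisModule.localMap (F (i + 1) (k + 1 + i + 1)) (Sum.inr v)) 1)
    (fun i ↦ galoisCohomology.map (DiscreteGaloisModule.localMap (DiscreteGaloisModule.restrictMap (F (k + 1 + i + 1) (i + 1))
      cd.conj) (Sum.inr v)) 1)
    (fun i ξ hξ ↦ by
      have h := W.eisensteinTower_pow_smul_apply_eq_map_transfer κ hm (Sum.inr v) (Nat.le_add_left i (k + 1)) hξ
      rwa [Nat.add_sub_cancel] at h)
    (fun i η' hη' ↦ W.eisensteinTower_map_transfer_apply_of_mem_compatibleFamilies_twist κ hm cd (Sum.inr v)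
      (Nat.le_add_left i (k + 1)) hη')
    (fun i x w ↦ (W.eisensteinTower_localCup_transfer_adjoint' κ hm cd D he_red (Nat.le_add_left i (k + 1)) (Sum.inr v)
      (ιmod i) (hι₁ i) x w).symm)
    η hη hη0
  exact ⟨y'', hy'', h⟩

end WeierstrassCurve

end
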